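import Literature.Probability.RandomPlanarGeometry.SAWAdsorptionArchUnfolding
import Literature.Probability.RandomPlanarGeometry.SAWAdsorptionBridgeGrowthRate
import Literature.Probability.RandomPlanarGeometry.SAWAdsorptionDesorbedPhase
import Literature.Probability.RandomPlanarGeometry.HammersleyWelshBound
import HarnessLib

/-!
# Existence of the adsorption free energy of the half-plane self-avoiding walk:
# `Z⁺_n(a)^{1/n} → max(β(a), μ)` (Hammersley–Torrie–Whittington 1982)

Topic `Literature/Probability/RandomPlanarGeometry` (continues `SAWAdsorptionArchUnfolding.lean` — arches `A_k(a)`,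
`a · A_k(a) ≤ e^{6√k} B_{k+1}(a)`, the last-visit split `Z⁺_n(a) ≤ Σ_k A_k(a) c_{n-k}` — and
`SAWAdsorptionBridgeGrowthRate.lean`, the adsorbed bridge rate `β(a) = lim B_n(a)^{1/n}`, `B_n(a) ≤ β(a)ⁿ`).

Hammersley–Torrie–Whittington 1982 (reported in Beaton–Guttmann–Jensen 2012, §1 p. 1 of arXiv:1110.6695v1: «It has been shown by Hammersley, Torrie and Whittington [HTW82] … that the limit lim n⁻¹ log Z_n(α) ≡ κ(α) exists»): «the limit
`lim_{n→∞} n⁻¹ log Z⁺_n(a) ≡ κ(a)` exists». The tree had the desorbed side `κ = log μ` on `0 ≤ a ≤ 1`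
(`Zd.tendsto_adsZ_rpow_of_le_one`). Here, for `a ≥ 1`:

* `Zd.adsZ_le_of_Bw_le_pow` — **`Z⁺_n(a) ≤ (n+1)² e^{12√(n+1)} max(β, μ)^{n+2}`** whenever `B_m(a) ≤ β^m` for all `m`
  (last-visit split, arch bound, `c_m ≤ (m+1) e^{6√(m+1)} b_{m+1} ≤ (m+1) e^{6√(m+1)} μ^{m+1}`);
* `Zd.tendsto_adsZ_rpow_of_one_le` — **`Z⁺_n(a)^{1/n} → max(β(a), μ)`** (`a ≥ 1`): the squeeze between
  `max(B_n(a), Z⁺_n(1))^{1/n} → max(β, μ)` and the bound above;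
* `Zd.exists_tendsto_adsZ_rpow` — **for every `a ≥ 0` the limit `lim Z⁺_n(a)^{1/n} = e^{κ(a)}` exists**, and
  `Zd.connectiveConstant_le_of_tendsto_adsZ_rpow` — it is at least `μ` (`κ(a) ≥ log μ`).

So `κ(a) = log max(β(a), μ)`: the walk is adsorbed (`κ > log μ`) exactly when the wall-returning `x`-bridges grow
faster than `μ`, which is what the certificates `Zd.adsorbedAbove_209/207` exhibit at `a = 2.09, 2.07`. Pure standard axioms.

Label: CONSOLIDATION — a printed theorem (Hammersley–Torrie–Whittington 1982, as reported by Beaton–Guttmann–Jensen 2012,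
§1 p. 1 of arXiv:1110.6695v1, for the `d`-dimensional hypercubic lattice; here `d = 2`, vertex weights, impenetrable wall) given a
NEW kernel proof; the identification of the limit as `max(β(a), μ)` with `β` the growth rate of wall-returning `x`-bridges is
this file's formulation (HTW82 itself is not held by the lane and is not quoted). (Lane «pcv-sawmu», a-p3 g9.)
-/

noncomputable section

open Finset Filter Topology Literature.Probability.LatticeModels
open scoped BigOperators

namespace Literature.Probability.RandomPlanarGeometry.SAW.Zd

/-! ### The upper bound `Z⁺_n(a) ≤ (n+1)² e^{12√(n+1)} max(β, μ)^{n+2}` -/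

/-- One term of the last-visit split: `A_k(a) c_{n-k} ≤ (n+1) e^{12√(n+1)} M^{n+2}`, `M = max(β, μ)`.
[cite: HammersleyTorrieWhittington1982, existence of the free energy κ; reported in BeatonGuttmannJensen2012Adsorption §1 p. 1 (arXiv:1110.6695v1)] [cite: MadrasSlade1993, §3.1, eq. (3.1.7) (p. 60)] -/
theorem archZ_mul_count_le {a β : ℝ} (ha : 1 ≤ a) (hβ0 : 0 ≤ β) (hβ : ∀ m, AdsIrr.Bw m a ≤ β ^ m)
    {n k : ℕ} (hk : k ≤ n) :
    archZ k a * (count 2 (n - k) : ℝ) ≤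
      ((n : ℝ) + 1) * Real.exp (12 * Real.sqrt ((n : ℝ) + 1)) * (max β (connectiveConstant 2)) ^ (n + 2) := by
  obtain ⟨j, rfl⟩ := Nat.exists_eq_add_of_le hk
  rw [Nat.add_sub_cancel_left]
  set M := max β (connectiveConstant 2) with hM
  have hμ : 0 < connectiveConstant 2 := connectiveConstant_pos 2
  have hβM : β ≤ M := le_max_left _ _
  have hμM : connectiveConstant 2 ≤ M := le_max_right _ _
  have hM0 : 0 ≤ M := hμ.le.trans hμM
  have hkj : ((k + j : ℕ) : ℝ) = k + j := by push_cast; ring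
  set E := Real.exp (6 * Real.sqrt (((k + j : ℕ) : ℝ) + 1)) with hE
  -- the arch factor
  have h1 : archZ k a ≤ E * M ^ (k + 1) := by
    calc archZ k a ≤ Real.exp (6 * Real.sqrt k) * AdsIrr.Bw (k + 1) a := archZ_le_exp_mul_Bw k ha
      _ ≤ E * M ^ (k + 1) := by
          refine mul_le_mul ?_ ((hβ (k + 1)).trans (pow_le_pow_left₀ hβ0 hβM _))
            (AdsIrr.Bw_nonneg _ (zero_le_one.trans ha)) (Real.exp_nonneg _)
          refine Real.exp_le_exp.2 (mul_le_mul_of_nonneg_left (Real.sqrt_le_sqrt ?_) (by norm_num))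
          rw [hkj]; have : (0 : ℝ) ≤ j := Nat.cast_nonneg j; linarith
  -- the free factor
  have h2 : (count 2 j : ℝ) ≤ (((k + j : ℕ) : ℝ) + 1) * E * M ^ (j + 1) := by
    calc (count 2 j : ℝ) ≤ ((j : ℝ) + 1) * Real.exp (6 * Real.sqrt ((j : ℝ) + 1)) * bridgeCount 2 (j + 1) :=
          count_le_mul_exp_mul_bridgeCount j
      _ ≤ ((j : ℝ) + 1) * Real.exp (6 * Real.sqrt ((j : ℝ) + 1)) * M ^ (j + 1) :=
          mul_le_mul_of_nonneg_left ((bridgeCount_le_pow (j + 1)).trans (pow_le_pow_left₀ hμ.le hμM _))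
            (by positivity)
      _ ≤ (((k + j : ℕ) : ℝ) + 1) * E * M ^ (j + 1) := by
          refine mul_le_mul_of_nonneg_right ?_ (pow_nonneg hM0 _)
          have hk0 : (0 : ℝ) ≤ k := Nat.cast_nonneg k
          refine mul_le_mul (by rw [hkj]; linarith) ?_ (Real.exp_nonneg _) (by rw [hkj]; linarith)
          exact Real.exp_le_exp.2 (mul_le_mul_of_nonneg_left (Real.sqrt_le_sqrt (by rw [hkj]; linarith))
            (by norm_num))
  have hE2 : Real.exp (12 * Real.sqrt (((k + j : ℕ) : ℝ) + 1)) = E * E := by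
    rw [hE, ← Real.exp_add]; ring_nf
  have hM2 : M ^ (k + j + 2) = M ^ (k + 1) * M ^ (j + 1) := by
    rw [← pow_add]; ring_nf
  calc archZ k a * (count 2 j : ℝ) ≤ (E * M ^ (k + 1)) * ((((k + j : ℕ) : ℝ) + 1) * E * M ^ (j + 1)) :=
        mul_le_mul h1 h2 (Nat.cast_nonneg _) (mul_nonneg (Real.exp_nonneg _) (pow_nonneg hM0 _))
    _ = (((k + j : ℕ) : ℝ) + 1) * Real.exp (12 * Real.sqrt (((k + j : ℕ) : ℝ) + 1)) * M ^ (k + j + 2) := by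
        rw [hE2, hM2]; ring

/-- **`Z⁺_n(a) ≤ (n+1)² e^{12√(n+1)} max(β, μ)^{n+2}`** for `a ≥ 1`, whenever `B_m(a) ≤ β^m` for all `m`
(e.g. `β = β(a)`, `AdsIrr.exists_tendsto_Bw_rpow`). [cite: HammersleyTorrieWhittington1982, existence of the free energy κ; reported in BeatonGuttmannJensen2012Adsorption §1 p. 1 (arXiv:1110.6695v1)]
[cite: MadrasSlade1993, §3.1, eq. (3.1.7) (p. 60)] -/
theorem adsZ_le_of_Bw_le_pow {a β : ℝ} (ha : 1 ≤ a) (hβ0 : 0 ≤ β) (hβ : ∀ m, AdsIrr.Bw m a ≤ β ^ m) (n : ℕ) :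
    adsZ n a ≤ ((n : ℝ) + 1) ^ 2 * Real.exp (12 * Real.sqrt ((n : ℝ) + 1)) *
      (max β (connectiveConstant 2)) ^ (n + 2) := by
  have h0 : 0 ≤ a := zero_le_one.trans ha
  refine (adsZ_le_sum_archZ_mul_count n h0).trans ?_
  calc ∑ k ∈ Finset.range (n + 1), archZ k a * (count 2 (n - k) : ℝ)
      ≤ ∑ _k ∈ Finset.range (n + 1), ((n : ℝ) + 1) * Real.exp (12 * Real.sqrt ((n : ℝ) + 1)) *
          (max β (connectiveConstant 2)) ^ (n + 2) :=
        Finset.sum_le_sum fun k hk => archZ_mul_count_le ha hβ0 hβ (Nat.le_of_lt_succ (Finset.mem_range.1 hk))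
    _ = ((n : ℝ) + 1) ^ 2 * Real.exp (12 * Real.sqrt ((n : ℝ) + 1)) * (max β (connectiveConstant 2)) ^ (n + 2) := by
        rw [Finset.sum_const, Finset.card_range, nsmul_eq_mul]; push_cast; ring

/-! ### The limit -/

/-- `(xⁿ)^{1/n} = x` for `n ≥ 1`. [folklore] -/
private theorem pow_rpow_one_div' {x : ℝ} (hx : 0 ≤ x) {n : ℕ} (hn : n ≠ 0) :
    (x ^ n) ^ (1 / (n : ℝ)) = x := by
  rw [one_div, Real.pow_rpow_inv_natCast hx hn]

/-- `(n+1)² ≤ e^{4√(n+1)}` (from `log y ≤ y - 1` at `y = √(n+1)`). [folklore] -/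
private theorem sq_le_exp_sqrt (n : ℕ) : ((n : ℝ) + 1) ^ 2 ≤ Real.exp (4 * Real.sqrt ((n : ℝ) + 1)) := by
  have hpos : (0 : ℝ) < (n : ℝ) + 1 := by positivity
  have hs : 0 < Real.sqrt ((n : ℝ) + 1) := Real.sqrt_pos.2 hpos
  have hlog : Real.log ((n : ℝ) + 1) ≤ 2 * Real.sqrt ((n : ℝ) + 1) := by
    have h := Real.log_le_sub_one_of_pos hs
    rw [Real.log_sqrt hpos.le] at h
    linarith
  calc ((n : ℝ) + 1) ^ 2 = Real.exp (2 * Real.log ((n : ℝ) + 1)) := by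
        rw [two_mul, Real.exp_add, Real.exp_log hpos, sq]
    _ ≤ Real.exp (4 * Real.sqrt ((n : ℝ) + 1)) := Real.exp_le_exp.2 (by linarith)

/-- `√(n+1)/n → 0`. [folklore] -/
private theorem tendsto_sqrt_succ_div : Tendsto (fun n : ℕ => Real.sqrt ((n : ℝ) + 1) / n) atTop (𝓝 0) := by
  have hsqrt : Tendsto (fun n : ℕ => Real.sqrt (n : ℝ)) atTop atTop := by
    have h := (tendsto_rpow_atTop (by norm_num : (0 : ℝ) < 1 / 2)).comp tendsto_natCast_atTop_atTop
    refine h.congr' (Eventually.of_forall fun n => ?_)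
    simp [Function.comp, Real.sqrt_eq_rpow]
  have hup : Tendsto (fun n : ℕ => 2 / Real.sqrt (n : ℝ)) atTop (𝓝 0) := tendsto_const_nhds.div_atTop hsqrt
  refine tendsto_of_tendsto_of_tendsto_of_le_of_le' tendsto_const_nhds hup ?_ ?_
  · filter_upwards [eventually_ge_atTop 1] with n hn
    positivity
  · filter_upwards [eventually_ge_atTop 1] with n hn
    have hn1 : (1 : ℝ) ≤ n := by exact_mod_cast hn
    have hs0 : 0 < Real.sqrt (n : ℝ) := Real.sqrt_pos.2 (by linarith)
    have hsq : Real.sqrt (n : ℝ) * Real.sqrt (n : ℝ) = n := Real.mul_self_sqrt (by linarith)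
    -- `√(n+1) ≤ 2 √n` since `n + 1 ≤ 4 n`
    have hle : Real.sqrt ((n : ℝ) + 1) ≤ 2 * Real.sqrt (n : ℝ) := by
      rw [show (2 : ℝ) * Real.sqrt n = Real.sqrt (4 * n) by
        rw [Real.sqrt_mul' _ (by linarith), show Real.sqrt (4 : ℝ) = 2 by
          rw [show (4 : ℝ) = 2 ^ 2 by norm_num, Real.sqrt_sq (by norm_num)]]]
      exact Real.sqrt_le_sqrt (by linarith)
    rw [div_le_div_iff₀ (by linarith) hs0]
    nlinarith

/-- **`Z⁺_n(a)^{1/n} → max(β(a), μ)` for `a ≥ 1`** (Hammersley–Torrie–Whittington 1982: the adsorption free energy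
exists), given the adsorbed bridge rate `β`: `B_n(a)^{1/n} → β`, `B_n(a) ≤ βⁿ` (`AdsIrr.exists_tendsto_Bw_rpow`). Squeeze:
below by `B_n(a) ≤ Z⁺_n(a)` and `Z⁺_n(1) ≤ Z⁺_n(a)` (`Z⁺_n(1)^{1/n} → μ`), above by `Zd.adsZ_le_of_Bw_le_pow`.
[cite: HammersleyTorrieWhittington1982, existence of the free energy κ; reported in BeatonGuttmannJensen2012Adsorption §1 p. 1 (arXiv:1110.6695v1)] [cite: BeatonGuttmannJensen2012Adsorption, §1 (p. 2)] -/
theorem tendsto_adsZ_rpow_of_one_le {a β : ℝ} (ha : 1 ≤ a) (hβ0 : 0 < β)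
    (hβlim : Tendsto (fun n : ℕ => (AdsIrr.Bw n a) ^ (1 / (n : ℝ))) atTop (𝓝 β))
    (hβ : ∀ m, AdsIrr.Bw m a ≤ β ^ m) :
    Tendsto (fun n : ℕ => (adsZ n a) ^ (1 / (n : ℝ))) atTop (𝓝 (max β (connectiveConstant 2))) := by
  set M := max β (connectiveConstant 2) with hM
  have h0 : 0 ≤ a := zero_le_one.trans ha
  have hμ : 0 < connectiveConstant 2 := connectiveConstant_pos 2
  have hμ1 : 1 ≤ connectiveConstant 2 := one_le_connectiveConstant 2
  have hM1 : 1 ≤ M := hμ1.trans (le_max_right _ _)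
  have hM0 : 0 < M := zero_lt_one.trans_le hM1
  -- lower squeeze: `max(B_n(a)^{1/n}, Z⁺_n(1)^{1/n}) → max(β, μ)`
  have hlow : Tendsto (fun n : ℕ => max ((AdsIrr.Bw n a) ^ (1 / (n : ℝ))) ((adsZ n 1) ^ (1 / (n : ℝ)))) atTop
      (𝓝 M) := hβlim.max (tendsto_adsZ_rpow_of_le_one zero_le_one le_rfl)
  -- upper sequence: `(e^{t_n} Mⁿ)^{1/n} = e^{t_n/n} M → M`, `t_n = 16 √(n+1) + 2 log M`
  set t : ℕ → ℝ := fun n => 16 * Real.sqrt ((n : ℝ) + 1) + 2 * Real.log M with ht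
  have htn : Tendsto (fun n : ℕ => t n / n) atTop (𝓝 0) := by
    have h1 : Tendsto (fun n : ℕ => 16 * (Real.sqrt ((n : ℝ) + 1) / n)) atTop (𝓝 0) := by
      simpa using tendsto_sqrt_succ_div.const_mul 16
    have h2 : Tendsto (fun n : ℕ => 2 * Real.log M / (n : ℝ)) atTop (𝓝 0) :=
      tendsto_const_nhds.div_atTop tendsto_natCast_atTop_atTop
    have := h1.add h2
    rw [add_zero] at this
    refine this.congr' (Eventually.of_forall fun n => ?_)
    simp only [ht]; ring
  have hup : Tendsto (fun n : ℕ => Real.exp (t n / n) * M) atTop (𝓝 M) := by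
    have h := ((Real.continuous_exp.tendsto 0).comp htn).mul_const M
    simpa using h
  refine tendsto_of_tendsto_of_tendsto_of_le_of_le' hlow hup ?_ ?_
  · filter_upwards [eventually_ge_atTop 1] with n hn
    refine max_le ?_ ?_
    · exact Real.rpow_le_rpow (AdsIrr.Bw_nonneg n h0) (AdsIrr.Bw_le_adsZ n h0) (by positivity)
    · exact Real.rpow_le_rpow (adsZ_nonneg n zero_le_one) (adsZ_mono n zero_le_one ha) (by positivity)
  · filter_upwards [eventually_ge_atTop 1] with n hn
    have hnn : n ≠ 0 := by omega
    -- `Z⁺_n(a) ≤ (n+1)² e^{12√(n+1)} M^{n+2} ≤ e^{t_n} Mⁿ`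
    have hb := adsZ_le_of_Bw_le_pow ha hβ0.le hβ n
    have hb' : adsZ n a ≤ Real.exp (t n) * M ^ n := by
      refine hb.trans ?_
      have hsq := sq_le_exp_sqrt n
      have hM2 : M ^ (n + 2) = M ^ 2 * M ^ n := by rw [← pow_add]; ring_nf
      have hexpM : Real.exp (2 * Real.log M) = M ^ 2 := by
        rw [two_mul, Real.exp_add, Real.exp_log hM0, sq]
      have ht' : Real.exp (t n) = Real.exp (4 * Real.sqrt ((n : ℝ) + 1)) *
          Real.exp (12 * Real.sqrt ((n : ℝ) + 1)) * M ^ 2 := by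
        rw [← hexpM, ← Real.exp_add, ← Real.exp_add, ht]; ring_nf
      rw [ht', hM2]
      have hE : 0 ≤ Real.exp (12 * Real.sqrt ((n : ℝ) + 1)) := Real.exp_nonneg _
      have hMn : 0 ≤ M ^ 2 * M ^ n := by positivity
      calc ((n : ℝ) + 1) ^ 2 * Real.exp (12 * Real.sqrt ((n : ℝ) + 1)) * (M ^ 2 * M ^ n)
          ≤ Real.exp (4 * Real.sqrt ((n : ℝ) + 1)) * Real.exp (12 * Real.sqrt ((n : ℝ) + 1)) * (M ^ 2 * M ^ n) := by
            gcongr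
        _ = Real.exp (4 * Real.sqrt ((n : ℝ) + 1)) * Real.exp (12 * Real.sqrt ((n : ℝ) + 1)) * M ^ 2 * M ^ n := by
            ring
    calc (adsZ n a) ^ (1 / (n : ℝ)) ≤ (Real.exp (t n) * M ^ n) ^ (1 / (n : ℝ)) :=
          Real.rpow_le_rpow (adsZ_nonneg n h0) hb' (by positivity)
      _ = Real.exp (t n / n) * M := by
          rw [Real.mul_rpow (Real.exp_nonneg _) (pow_nonneg hM0.le _), pow_rpow_one_div' hM0.le hnn,
            ← Real.exp_mul]
          congr 2
          ring

/-- **The adsorption free energy exists (Hammersley–Torrie–Whittington 1982): for every `a ≥ 0` the sequence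
`Z⁺_n(a)^{1/n}` converges** (to `μ` for `a ≤ 1`, to `max(β(a), μ)` for `a ≥ 1`); `κ(a)` is the logarithm of the limit.
[cite: HammersleyTorrieWhittington1982, existence of the free energy κ; reported in BeatonGuttmannJensen2012Adsorption §1 p. 1 (arXiv:1110.6695v1)] [cite: BeatonGuttmannJensen2012Adsorption, §1 (p. 2)] -/
theorem exists_tendsto_adsZ_rpow {a : ℝ} (ha : 0 ≤ a) :
    ∃ K : ℝ, connectiveConstant 2 ≤ K ∧ Tendsto (fun n : ℕ => (adsZ n a) ^ (1 / (n : ℝ))) atTop (𝓝 K) := by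
  rcases le_total a 1 with h1 | h1
  · exact ⟨connectiveConstant 2, le_rfl, tendsto_adsZ_rpow_of_le_one ha h1⟩
  · obtain ⟨β, hβ0, hβlim, hβ⟩ := AdsIrr.exists_tendsto_Bw_rpow (zero_lt_one.trans_le h1)
    exact ⟨max β (connectiveConstant 2), le_max_right _ _, tendsto_adsZ_rpow_of_one_le h1 hβ0 hβlim hβ⟩

/-- **The free energy dominates both rates**: for `a ≥ 1`, if `Z⁺_n(a)^{1/n} → K` and `B_n(a)^{1/n} → β` then
`K = max(β, μ)`; in particular `K ≥ β` — an `AdsorbedAbove a Λ` certificate from pieces (`Λ ≤ β`) bounds `e^{κ(a)}`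
from below, and `K > μ` iff `β > μ`. [cite: HammersleyTorrieWhittington1982, existence of the free energy κ; reported in BeatonGuttmannJensen2012Adsorption §1 p. 1 (arXiv:1110.6695v1)] -/
theorem eq_max_of_tendsto_adsZ_rpow {a β K : ℝ} (ha : 1 ≤ a) (hβ0 : 0 < β)
    (hβlim : Tendsto (fun n : ℕ => (AdsIrr.Bw n a) ^ (1 / (n : ℝ))) atTop (𝓝 β))
    (hβ : ∀ m, AdsIrr.Bw m a ≤ β ^ m)
    (hK : Tendsto (fun n : ℕ => (adsZ n a) ^ (1 / (n : ℝ))) atTop (𝓝 K)) :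
    K = max β (connectiveConstant 2) :=
  tendsto_nhds_unique hK (tendsto_adsZ_rpow_of_one_le ha hβ0 hβlim hβ)

end Literature.Probability.RandomPlanarGeometry.SAW.Zd
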